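import Summits.ValiantsHypothesis.ValiantsHypothesis.Theorems.LacunarySymmetroidMatrixDescartesOsculationLawGPLogHessianMul

/-!
# ValiantsHypothesis / LacunarySymmetroid — crux `MatrixDescartes` (stmt-ValiantsHypothesis-18050, V1),
# line `Cruxes/MatrixDescartes/Lines/osculation_law.lean` («osculation-law»): BLOCK-SUM ADDITIVITY, STRADDLING HALF —
# the osculation set of a block sum of two block pencils is the union of theirs plus the sheet crossings

Rung O5 of the line, third file (seat val-sym-trop-p4 (g16), 2026-08-28; `--supports stmt-ValiantsHypothesis-18050 --as helper`).
Two block pencils `S₁` on `Fin r₁ ⊕ Fin s₁` and `S₂` on `Fin r₂ ⊕ Fin s₂`, BOTH meeting the inserted letter; their block sum in the line's frame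
at the splitting `(r₁ + r₂, s₁ + s₂)` is `S l = reindex e e (fromBlocks (S₁ l) 0 0 (S₂ l))` with the shuffle
`e = (Equiv.sumSumSumComm _ _ _ _).trans (Equiv.sumCongr finSumFinEquiv finSumFinEquiv)`, under which the line's projector
`I_{r₁+r₂} ⊕ 0` is the block sum of the two projectors (`blockProj_blockSum`).  Hence `Φ(S) = Φ(S₁) · Φ(S₂)` (`insertionPoly_blockSum`) and, by the
product rule for the bordered log-Hessian (`OsculationGeneric.eval_logHessian_mul_of_eval_eq_zero`), EXACTLY

  `osc(S₁ ⊕ S₂) = osc(S₁) ∪ osc(S₂) ∪ {(t,b) : t > 0, b > 0, Φ₁(t,b) = 0 = Φ₂(t,b)}`   (`osculationSet_blockSum`, no hypothesis),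

so `#osc(S₁ ⊕ S₂) ≤ #osc S₁ + #osc S₂ + #(sheet crossings)` when these are finite (`osculation_ncard_blockSum_le`): the osculation count is
ADDITIVE over block sums up to the crossings of the two spectral curves (the interaction term; a Bezout-type quantity, not bounded here).
With `OsculationBlockSum.osculationSet_fromBlocks` (aligned half: a summand missing the letter counts zero) this is the block-sum law of the
line.  Vocabulary UNFOLDED verbatim as in `OsculationUniformRung.osculationLawAt_all`.

HONEST FRAMING.  A bookkeeping rung, not the LAW: `stub_osculationLaw`, the crux `MatrixDescartes` (stmt-18050), Conjecture B and `VP ≠ VNP`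
stay OPEN / NOT proved.  No definitions, no named facts.
-/

set_option linter.dupNamespace false
set_option autoImplicit false

noncomputable section

namespace Summit.ValiantsHypothesis.ValiantsHypothesis.Theorems.LacunarySymmetroidMatrixDescartes

open Polynomial Matrix Finset
open scoped BigOperators

namespace OsculationBlockSum

/-- **Osculation of a product** (pointwise, no hypothesis): `Φ = T₁·T₂` osculates at `p` iff `T₁` or `T₂` does, or both vanish at `p`
(a crossing of the two curves). [this seat's lemma] -/
theorem osc_mul_iff_union (T₁ T₂ : MvPolynomial (Fin 2) ℝ) (p : Fin 2 → ℝ) :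
    (MvPolynomial.eval p (T₁ * T₂) = 0 ∧ MvPolynomial.eval p
      (MvPolynomial.X 0 * MvPolynomial.pderiv 0 (MvPolynomial.X 0 * MvPolynomial.pderiv 0 (T₁ * T₂)) * (MvPolynomial.X 1 * MvPolynomial.pderiv 1 (T₁ * T₂)) ^ 2
      - 2 * (MvPolynomial.X 0 * MvPolynomial.pderiv 0 (MvPolynomial.X 1 * MvPolynomial.pderiv 1 (T₁ * T₂))) * (MvPolynomial.X 0 * MvPolynomial.pderiv 0 (T₁ * T₂)) * (MvPolynomial.X 1 * MvPolynomial.pderiv 1 (T₁ * T₂))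
      + MvPolynomial.X 1 * MvPolynomial.pderiv 1 (MvPolynomial.X 1 * MvPolynomial.pderiv 1 (T₁ * T₂)) * (MvPolynomial.X 0 * MvPolynomial.pderiv 0 (T₁ * T₂)) ^ 2) = 0) ↔
    ((MvPolynomial.eval p T₁ = 0 ∧ MvPolynomial.eval p
      (MvPolynomial.X 0 * MvPolynomial.pderiv 0 (MvPolynomial.X 0 * MvPolynomial.pderiv 0 T₁) * (MvPolynomial.X 1 * MvPolynomial.pderiv 1 T₁) ^ 2
      - 2 * (MvPolynomial.X 0 * MvPolynomial.pderiv 0 (MvPolynomial.X 1 * MvPolynomial.pderiv 1 T₁)) * (MvPolynomial.X 0 * MvPolynomial.pderiv 0 T₁) * (MvPolynomial.X 1 * MvPolynomial.pderiv 1 T₁)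
      + MvPolynomial.X 1 * MvPolynomial.pderiv 1 (MvPolynomial.X 1 * MvPolynomial.pderiv 1 T₁) * (MvPolynomial.X 0 * MvPolynomial.pderiv 0 T₁) ^ 2) = 0) ∨
     (MvPolynomial.eval p T₂ = 0 ∧ MvPolynomial.eval p
      (MvPolynomial.X 0 * MvPolynomial.pderiv 0 (MvPolynomial.X 0 * MvPolynomial.pderiv 0 T₂) * (MvPolynomial.X 1 * MvPolynomial.pderiv 1 T₂) ^ 2
      - 2 * (MvPolynomial.X 0 * MvPolynomial.pderiv 0 (MvPolynomial.X 1 * MvPolynomial.pderiv 1 T₂)) * (MvPolynomial.X 0 * MvPolynomial.pderiv 0 T₂) * (MvPolynomial.X 1 * MvPolynomial.pderiv 1 T₂)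
      + MvPolynomial.X 1 * MvPolynomial.pderiv 1 (MvPolynomial.X 1 * MvPolynomial.pderiv 1 T₂) * (MvPolynomial.X 0 * MvPolynomial.pderiv 0 T₂) ^ 2) = 0) ∨
     (MvPolynomial.eval p T₁ = 0 ∧ MvPolynomial.eval p T₂ = 0)) := by
  have prod1 := OsculationGeneric.eval_logHessian_mul_of_eval_eq_zero T₁ T₂ p
  have prod2 := OsculationGeneric.eval_logHessian_mul_of_eval_eq_zero T₂ T₁ p
  rw [mul_comm T₂ T₁] at prod2
  constructor
  · rintro ⟨hΦ, hH⟩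
    rw [map_mul] at hΦ
    rcases mul_eq_zero.mp hΦ with h1 | h2
    · by_cases h2 : MvPolynomial.eval p T₂ = 0
      · exact Or.inr (Or.inr ⟨h1, h2⟩)
      · left
        refine ⟨h1, ?_⟩
        rw [prod1 h1] at hH
        rcases mul_eq_zero.mp hH with h | h
        · exact absurd (pow_eq_zero_iff (by norm_num) |>.mp h) h2
        · exact h
    · by_cases h1 : MvPolynomial.eval p T₁ = 0
      · exact Or.inr (Or.inr ⟨h1, h2⟩)
      · right; left
        refine ⟨h2, ?_⟩
        rw [prod2 h2] at hH
        rcases mul_eq_zero.mp hH with h | h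
        · exact absurd (pow_eq_zero_iff (by norm_num) |>.mp h) h1
        · exact h
  · rintro (⟨h1, hH⟩ | ⟨h2, hH⟩ | ⟨h1, h2⟩)
    · exact ⟨by rw [map_mul, h1, zero_mul], by rw [prod1 h1, hH, mul_zero]⟩
    · exact ⟨by rw [map_mul, h2, mul_zero], by rw [prod2 h2, hH, mul_zero]⟩
    · exact ⟨by rw [map_mul, h1, zero_mul], by rw [prod1 h1, h2, zero_pow three_ne_zero, zero_mul]⟩

/-- Set form of `osc_mul_iff_union`: the osculation set of a product is the union of the factors' osculation sets and the crossing
set. [this seat's lemma] -/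
theorem osc_set_mul (T₁ T₂ : MvPolynomial (Fin 2) ℝ) :
    {p : Fin 2 → ℝ | 0 < p 0 ∧ 0 < p 1 ∧ MvPolynomial.eval p (T₁ * T₂) = 0 ∧
      MvPolynomial.eval p
        (MvPolynomial.X 0 * MvPolynomial.pderiv 0 (MvPolynomial.X 0 * MvPolynomial.pderiv 0 (T₁ * T₂)) * (MvPolynomial.X 1 * MvPolynomial.pderiv 1 (T₁ * T₂)) ^ 2
      - 2 * (MvPolynomial.X 0 * MvPolynomial.pderiv 0 (MvPolynomial.X 1 * MvPolynomial.pderiv 1 (T₁ * T₂))) * (MvPolynomial.X 0 * MvPolynomial.pderiv 0 (T₁ * T₂)) * (MvPolynomial.X 1 * MvPolynomial.pderiv 1 (T₁ * T₂))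
      + MvPolynomial.X 1 * MvPolynomial.pderiv 1 (MvPolynomial.X 1 * MvPolynomial.pderiv 1 (T₁ * T₂)) * (MvPolynomial.X 0 * MvPolynomial.pderiv 0 (T₁ * T₂)) ^ 2) = 0}
      = ({p : Fin 2 → ℝ | 0 < p 0 ∧ 0 < p 1 ∧ MvPolynomial.eval p T₁ = 0 ∧
      MvPolynomial.eval p
        (MvPolynomial.X 0 * MvPolynomial.pderiv 0 (MvPolynomial.X 0 * MvPolynomial.pderiv 0 T₁) * (MvPolynomial.X 1 * MvPolynomial.pderiv 1 T₁) ^ 2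
      - 2 * (MvPolynomial.X 0 * MvPolynomial.pderiv 0 (MvPolynomial.X 1 * MvPolynomial.pderiv 1 T₁)) * (MvPolynomial.X 0 * MvPolynomial.pderiv 0 T₁) * (MvPolynomial.X 1 * MvPolynomial.pderiv 1 T₁)
      + MvPolynomial.X 1 * MvPolynomial.pderiv 1 (MvPolynomial.X 1 * MvPolynomial.pderiv 1 T₁) * (MvPolynomial.X 0 * MvPolynomial.pderiv 0 T₁) ^ 2) = 0}
        ∪ {p : Fin 2 → ℝ | 0 < p 0 ∧ 0 < p 1 ∧ MvPolynomial.eval p T₂ = 0 ∧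
      MvPolynomial.eval p
        (MvPolynomial.X 0 * MvPolynomial.pderiv 0 (MvPolynomial.X 0 * MvPolynomial.pderiv 0 T₂) * (MvPolynomial.X 1 * MvPolynomial.pderiv 1 T₂) ^ 2
      - 2 * (MvPolynomial.X 0 * MvPolynomial.pderiv 0 (MvPolynomial.X 1 * MvPolynomial.pderiv 1 T₂)) * (MvPolynomial.X 0 * MvPolynomial.pderiv 0 T₂) * (MvPolynomial.X 1 * MvPolynomial.pderiv 1 T₂)
      + MvPolynomial.X 1 * MvPolynomial.pderiv 1 (MvPolynomial.X 1 * MvPolynomial.pderiv 1 T₂) * (MvPolynomial.X 0 * MvPolynomial.pderiv 0 T₂) ^ 2) = 0})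
        ∪ {p : Fin 2 → ℝ | 0 < p 0 ∧ 0 < p 1 ∧ MvPolynomial.eval p T₁ = 0 ∧
      MvPolynomial.eval p T₂ = 0} := by
  ext p
  simp only [Set.mem_setOf_eq, Set.mem_union]
  constructor
  · rintro ⟨h0, h1, h⟩
    rcases (osc_mul_iff_union T₁ T₂ p).mp h with hA | hB | hC
    · exact Or.inl (Or.inl ⟨h0, h1, hA⟩)
    · exact Or.inl (Or.inr ⟨h0, h1, hB⟩)
    · exact Or.inr ⟨h0, h1, hC⟩
  · rintro ((⟨h0, h1, hA⟩ | ⟨h0, h1, hB⟩) | ⟨h0, h1, hC⟩)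
    · exact ⟨h0, h1, (osc_mul_iff_union T₁ T₂ p).mpr (Or.inl hA)⟩
    · exact ⟨h0, h1, (osc_mul_iff_union T₁ T₂ p).mpr (Or.inr (Or.inl hB))⟩
    · exact ⟨h0, h1, (osc_mul_iff_union T₁ T₂ p).mpr (Or.inr (Or.inr hC))⟩

variable {r₁ s₁ r₂ s₂ K : ℕ}

/-- The shuffle `e` on the four kinds of indices. [folklore] -/
theorem shuffle_apply (x : (Fin r₁ ⊕ Fin s₁) ⊕ (Fin r₂ ⊕ Fin s₂)) :
    ((Equiv.sumSumSumComm (Fin r₁) (Fin s₁) (Fin r₂) (Fin s₂)).trans (Equiv.sumCongr finSumFinEquiv finSumFinEquiv)) x =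
      Sum.elim (Sum.elim (fun a => Sum.inl (finSumFinEquiv (Sum.inl a))) (fun b => Sum.inr (finSumFinEquiv (Sum.inl b))))
        (Sum.elim (fun c => Sum.inl (finSumFinEquiv (Sum.inr c))) (fun d => Sum.inr (finSumFinEquiv (Sum.inr d)))) x := by
  rcases x with (a | b) | (c | d) <;> rfl

/-- **The line's projector is the block sum of the two projectors** under the shuffle. [this seat's lemma] -/
theorem blockProj_blockSum :
    (Matrix.fromBlocks 1 0 0 0 : Matrix (Fin (r₁ + r₂) ⊕ Fin (s₁ + s₂)) (Fin (r₁ + r₂) ⊕ Fin (s₁ + s₂)) ℝ) =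
      Matrix.reindex ((Equiv.sumSumSumComm (Fin r₁) (Fin s₁) (Fin r₂) (Fin s₂)).trans (Equiv.sumCongr finSumFinEquiv finSumFinEquiv))
        ((Equiv.sumSumSumComm (Fin r₁) (Fin s₁) (Fin r₂) (Fin s₂)).trans (Equiv.sumCongr finSumFinEquiv finSumFinEquiv))
        (Matrix.fromBlocks (Matrix.fromBlocks 1 0 0 0 : Matrix (Fin r₁ ⊕ Fin s₁) (Fin r₁ ⊕ Fin s₁) ℝ) 0 0
          (Matrix.fromBlocks 1 0 0 0 : Matrix (Fin r₂ ⊕ Fin s₂) (Fin r₂ ⊕ Fin s₂) ℝ)) := by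
  set e := ((Equiv.sumSumSumComm (Fin r₁) (Fin s₁) (Fin r₂) (Fin s₂)).trans (Equiv.sumCongr finSumFinEquiv finSumFinEquiv)) with he
  ext x y
  obtain ⟨x', rfl⟩ := e.surjective x
  obtain ⟨y', rfl⟩ := e.surjective y
  rw [Matrix.reindex_apply, Matrix.submatrix_apply, Equiv.symm_apply_apply, Equiv.symm_apply_apply, he,
    shuffle_apply, shuffle_apply]
  rcases x' with (a | b) | (c | d) <;> rcases y' with (a' | b') | (c' | d') <;>
    simp [Matrix.fromBlocks_apply₁₁, Matrix.fromBlocks_apply₁₂, Matrix.fromBlocks_apply₂₁, Matrix.fromBlocks_apply₂₂,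
      Matrix.one_apply, Fin.ext_iff] <;> omega

/-- The pencil-plus-letter matrix of the block sum is the shuffled block sum of the two pencil-plus-letter matrices. [folklore] -/
theorem pencil_blockSum (d : Fin K → ℕ) (S₁ : Fin K → Matrix (Fin r₁ ⊕ Fin s₁) (Fin r₁ ⊕ Fin s₁) ℝ)
    (S₂ : Fin K → Matrix (Fin r₂ ⊕ Fin s₂) (Fin r₂ ⊕ Fin s₂) ℝ) :
    (∑ l, (MvPolynomial.X (0 : Fin 2) : MvPolynomial (Fin 2) ℝ) ^ d l •
              (Matrix.reindex ((Equiv.sumSumSumComm (Fin r₁) (Fin s₁) (Fin r₂) (Fin s₂)).trans (Equiv.sumCongr finSumFinEquiv finSumFinEquiv)) ((Equiv.sumSumSumComm (Fin r₁) (Fin s₁) (Fin r₂) (Fin s₂)).trans (Equiv.sumCongr finSumFinEquiv finSumFinEquiv)) (Matrix.fromBlocks (S₁ l) 0 0 (S₂ l))).map (MvPolynomial.C : ℝ →+* MvPolynomial (Fin 2) ℝ)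
            + (MvPolynomial.X (1 : Fin 2) : MvPolynomial (Fin 2) ℝ) •
              (Matrix.fromBlocks 1 0 0 0 : Matrix (Fin (r₁ + r₂) ⊕ Fin (s₁ + s₂)) (Fin (r₁ + r₂) ⊕ Fin (s₁ + s₂)) ℝ).map
                (MvPolynomial.C : ℝ →+* MvPolynomial (Fin 2) ℝ))
      = Matrix.reindex ((Equiv.sumSumSumComm (Fin r₁) (Fin s₁) (Fin r₂) (Fin s₂)).trans (Equiv.sumCongr finSumFinEquiv finSumFinEquiv))
          ((Equiv.sumSumSumComm (Fin r₁) (Fin s₁) (Fin r₂) (Fin s₂)).trans (Equiv.sumCongr finSumFinEquiv finSumFinEquiv))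
          (Matrix.fromBlocks (∑ l, (MvPolynomial.X (0 : Fin 2) : MvPolynomial (Fin 2) ℝ) ^ d l •
              (S₁ l).map (MvPolynomial.C : ℝ →+* MvPolynomial (Fin 2) ℝ)
            + (MvPolynomial.X (1 : Fin 2) : MvPolynomial (Fin 2) ℝ) •
              (Matrix.fromBlocks 1 0 0 0 : Matrix (Fin r₁ ⊕ Fin s₁) (Fin r₁ ⊕ Fin s₁) ℝ).map
                (MvPolynomial.C : ℝ →+* MvPolynomial (Fin 2) ℝ)) 0 0 (∑ l, (MvPolynomial.X (0 : Fin 2) : MvPolynomial (Fin 2) ℝ) ^ d l •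
              (S₂ l).map (MvPolynomial.C : ℝ →+* MvPolynomial (Fin 2) ℝ)
            + (MvPolynomial.X (1 : Fin 2) : MvPolynomial (Fin 2) ℝ) •
              (Matrix.fromBlocks 1 0 0 0 : Matrix (Fin r₂ ⊕ Fin s₂) (Fin r₂ ⊕ Fin s₂) ℝ).map
                (MvPolynomial.C : ℝ →+* MvPolynomial (Fin 2) ℝ))) := by
  rw [blockProj_blockSum]
  set e := ((Equiv.sumSumSumComm (Fin r₁) (Fin s₁) (Fin r₂) (Fin s₂)).trans (Equiv.sumCongr finSumFinEquiv finSumFinEquiv)) with he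
  refine Matrix.ext fun x y => ?_
  obtain ⟨x', rfl⟩ := e.surjective x
  obtain ⟨y', rfl⟩ := e.surjective y
  simp only [Matrix.add_apply, Matrix.sum_apply, Matrix.smul_apply, Matrix.map_apply, Matrix.reindex_apply,
    Matrix.submatrix_apply, Equiv.symm_apply_apply]
  rcases x' with x' | x' <;> rcases y' with y' | y'
  · simp only [Matrix.fromBlocks_apply₁₁, Matrix.add_apply, Matrix.sum_apply, Matrix.smul_apply, Matrix.map_apply]
  · simp only [Matrix.fromBlocks_apply₁₂, Matrix.zero_apply, map_zero, smul_zero, Finset.sum_const_zero, add_zero]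
  · simp only [Matrix.fromBlocks_apply₂₁, Matrix.zero_apply, map_zero, smul_zero, Finset.sum_const_zero, add_zero]
  · simp only [Matrix.fromBlocks_apply₂₂, Matrix.add_apply, Matrix.sum_apply, Matrix.smul_apply, Matrix.map_apply]

/-- **Factorisation**: `Φ(S₁ ⊕ S₂) = Φ(S₁) · Φ(S₂)`. [this seat's lemma] -/
theorem insertionPoly_blockSum (d : Fin K → ℕ) (S₁ : Fin K → Matrix (Fin r₁ ⊕ Fin s₁) (Fin r₁ ⊕ Fin s₁) ℝ)
    (S₂ : Fin K → Matrix (Fin r₂ ⊕ Fin s₂) (Fin r₂ ⊕ Fin s₂) ℝ) :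
    (∑ l, (MvPolynomial.X (0 : Fin 2) : MvPolynomial (Fin 2) ℝ) ^ d l •
              (Matrix.reindex ((Equiv.sumSumSumComm (Fin r₁) (Fin s₁) (Fin r₂) (Fin s₂)).trans (Equiv.sumCongr finSumFinEquiv finSumFinEquiv)) ((Equiv.sumSumSumComm (Fin r₁) (Fin s₁) (Fin r₂) (Fin s₂)).trans (Equiv.sumCongr finSumFinEquiv finSumFinEquiv)) (Matrix.fromBlocks (S₁ l) 0 0 (S₂ l))).map (MvPolynomial.C : ℝ →+* MvPolynomial (Fin 2) ℝ)
            + (MvPolynomial.X (1 : Fin 2) : MvPolynomial (Fin 2) ℝ) •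
              (Matrix.fromBlocks 1 0 0 0 : Matrix (Fin (r₁ + r₂) ⊕ Fin (s₁ + s₂)) (Fin (r₁ + r₂) ⊕ Fin (s₁ + s₂)) ℝ).map
                (MvPolynomial.C : ℝ →+* MvPolynomial (Fin 2) ℝ)).det
      = (∑ l, (MvPolynomial.X (0 : Fin 2) : MvPolynomial (Fin 2) ℝ) ^ d l •
              (S₁ l).map (MvPolynomial.C : ℝ →+* MvPolynomial (Fin 2) ℝ)
            + (MvPolynomial.X (1 : Fin 2) : MvPolynomial (Fin 2) ℝ) •
              (Matrix.fromBlocks 1 0 0 0 : Matrix (Fin r₁ ⊕ Fin s₁) (Fin r₁ ⊕ Fin s₁) ℝ).map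
                (MvPolynomial.C : ℝ →+* MvPolynomial (Fin 2) ℝ)).det * (∑ l, (MvPolynomial.X (0 : Fin 2) : MvPolynomial (Fin 2) ℝ) ^ d l •
              (S₂ l).map (MvPolynomial.C : ℝ →+* MvPolynomial (Fin 2) ℝ)
            + (MvPolynomial.X (1 : Fin 2) : MvPolynomial (Fin 2) ℝ) •
              (Matrix.fromBlocks 1 0 0 0 : Matrix (Fin r₂ ⊕ Fin s₂) (Fin r₂ ⊕ Fin s₂) ℝ).map
                (MvPolynomial.C : ℝ →+* MvPolynomial (Fin 2) ℝ)).det := by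
  rw [pencil_blockSum, Matrix.det_reindex_self, Matrix.det_fromBlocks_zero₂₁]

end OsculationBlockSum

end Summit.ValiantsHypothesis.ValiantsHypothesis.Theorems.LacunarySymmetroidMatrixDescartes
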